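/-
Copyright (c) 2026 the pub-hodgecm-mathlib formalisation cell (harness21).  Prover seat hodgecm-mathlib-F0P3a-p05 (g17): road «S3-ram» (LEAD F0P3a-plan (g12); owner∕table
F0P3a-p06 (g15)), the (a2) JUNCTION (J★) of F0P3a-p01 (g17): the literal of the head, normalised by its middle eigenvalue, as an element of `U(σ, J₀) ∩ GL₃(𝒪)` (the
`γ hγ0 hγA hs1 hsv hsσ hs0 hs2 hs02` binders of skeleton v2 :226 `strataCount_J₀_equilateral` from the head's data); 2026-09-02.
-/
import Literature.NumberTheory.Automorphic.UnitaryLatticeTreeIsTreeDiagonalRamified   -- ★ J1 p847380 (F0P2-p02 (g13)): `exists_glInt_diagonal_eq_smul_formCongr_antidiagonal` (the frame `A`), `isIntMatrix_diagonal_of_v_eq_one`, `v_det_diagonal_of_v_eq_one`; brings ★ `isIntMatrix_mul`, ★ `unitaryInt` ∕ `mem_unitaryInt_iff`, ★ `conj_mem_unitaryGroupOfForm`, ★ `unitaryGroupOfForm_smul_of_isUnit`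
import HarnessLib

/-!
# The lattice graph of a hermitian space — THE DIAGONAL LITERAL IN THE ANTIDIAGONAL MODEL: `A·diag(s)·A⁻¹ ∈ U(σ, J₀) ∩ GL₃(𝒪)` for the integral frame `A` of a diagonal unit
# form `diag d = (−det diag d)·ᵗσ(A) J₀ A` and `σ`-norm-one `s` (Rogawski 1990 §4.9, §3.6; Kottwitz 1986 §3; Bruhat–Tits 1972 §10)

Topic `NumberTheory/Automorphic`; namespace `Literature.NumberTheory.Automorphic.UnitaryLatticeTree`.  THEOREMS ONLY (no definition, no instance, no notation, no named fact,
no `sorry`); kernel lane `--supports stmt-HodgeConjecture-24833`; datum-free (`K` with `Valued K ℤᵐ⁰`, `σ` valuation-preserving where stated).  Cell `pub/hodgecm-mathlib`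
(D-0151), crux H413; road «S3-ram» (Literature seeding, count-neutral), organ A′e, the JUNCTION (J★) `stub_signedStrataCount_typeOne_ram` of F0P3a-p01 (g16∕g17), J-PACK v2
(03ef5f1f) §0: «THE ENGINE RUNS IN THE J₀-MODEL … `γ : unitaryGroupOfForm σ H₀` with `hγ0 : γ ∈ unitaryInt σ H₀` (= the literal `T` normalised by its MIDDLE eigenvalue,
`u⁻¹T = diag(α∕u, 1, γ∕u)`, conjugated by the ★ glInt frame `A_b` of `exists_glInt_diagonal_eq_smul_formCongr_antidiagonal` for `d_b`)».  The assembly statement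
`strataCount_J₀_equilateral` (skeleton v2 9e8236c2 :226) takes this element through the binders `{γ} (hγ0) (s) (hs1 : s 1 = 1) (hsv : ∀ i, |s i| = 1) (hsσ : ∀ i, s i·σ(s i) = 1)
(hγA : ↑γ = A·diag s·A⁻¹) (hs0) (hs2) (hs02)`; THIS FILE produces them from the head's data `(α, u, γ)` (`σ`-norm-one), the frame `A` (`A, A⁻¹` integral, `diag d = (−det diag d) •
formCongr σ A J₀`) and the head's depths — the glue between the D-head transport ★ p847541 (`T″ = diag(α∕u, 1, γ∕u)`, `γ′ = A·T″·A⁻¹ : GL`) and the engine's `γ ∈ unitaryInt`.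

THE MATHEMATICS (elementary; [Rogawski1990] §3.6 p. 31, §4.9 p. 55).  `D = diag(s)` with `sᵢ·σ(sᵢ) = 1` preserves every diagonal form with `σ`-fixed… indeed ANY diagonal form:
`ᵗσ(D)·diag(d)·D = diag(σ(sᵢ) dᵢ sᵢ) = diag(d)`; `U(σ, diag d) = U(σ, c • ᵗσ(A)J₀A) = U(σ, ᵗσ(A)J₀A)` for the unit `c = −det diag d` (★ `unitaryGroupOfForm_smul_of_isUnit`), so
`A·D·A⁻¹ ∈ U(σ, J₀)` (★ `conj_mem_unitaryGroupOfForm`); its entries and those of its inverse `A·diag(σ s)·A⁻¹` are integral (`|sᵢ| = |σ sᵢ| = 1`, `A, A⁻¹` integral).  For the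
normalised spectrum `s = (α∕u, 1, γ∕u)`: `s 1 = 1`, `sᵢσ(sᵢ) = 1`, `|sᵢ| = 1`, and `|α∕u − 1| = |α − u|`, `|γ∕u − 1| = |u − γ|`, `|α∕u − γ∕u| = |α − γ|` (`|u| = 1`) — the head's
depths `N₁, N₂, N` are the engine's.
HONEST LABEL: HC_CM is proved only modulo the 2 remaining named inputs (hLiu418 24832, h413 24833) until rung 0 closes; nothing printed is asserted here (matrix bookkeeping).

* §1 `v_eq_one_of_mul_map_eq_one`, `div_mul_map_div_eq_one`, `v_div_sub_one_eq`, `v_div_sub_div_eq`.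
* §2 `exists_unitary_diagonal_coe_eq_diagonal` (`T ∈ U(σ, diag d)`, `↑T = diag s`), **`exists_mem_unitaryInt_coe_eq_conj_diagonal`** (`∃ γ ∈ unitaryInt σ J₀, ↑γ = A·diag(s)·A⁻¹`), **`exists_mem_unitaryInt_coe_eq_conj_diagonal_div`** (the head's
  `s = (α∕u, 1, γ∕u)` with `hs1 hsv hsσ`), `v_spectrum_div_sub` (`hs0 hs2 hs02` from `hN₁ hN₂ hN`).

## References
* [Rogawski1990] J. D. Rogawski, *Automorphic Representations of Unitary Groups in Three Variables*, Ann. of Math. Stud. 123 (1990), §3.6 p. 31 (diagonal tori), §4.9 p. 55.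
* [Kottwitz1986] R. E. Kottwitz, *Base change for unit elements of Hecke algebras*, Compositio Math. 60 (1986), §3 (fixed lattices of an integral elliptic element).
* [BruhatTits1972] F. Bruhat, J. Tits, *Groupes réductifs sur un corps local I*, Publ. Math. IHÉS 41 (1972), §10 (the hyperspecial stabiliser `U ∩ GL_N(𝒪)`).
* [Serre1980Trees] J.-P. Serre, *Trees* (1980), Ch. II §1.1.
-/

set_option autoImplicit false

noncomputable section

open scoped Valued WithZero Matrix MatrixGroups

namespace Literature.NumberTheory.Automorphic.UnitaryLatticeTree

open Literature.NumberTheory.Automorphic Literature.NumberTheory.Automorphic.HermitianLattice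

variable {K : Type*} [Field K] [Valued K ℤᵐ⁰] {σ : K →+* K}

/-! ## §1 Norm-one scalars: valuation identities for the normalised spectrum `(α∕u, 1, γ∕u)` -/

/-- A `σ`-norm-one element is a unit of `𝒪`: `x·σx = 1 ⇒ |x| = 1` (`σ` valuation-preserving). [cite: Rogawski1990, §3.6 p. 31] -/
theorem v_eq_one_of_mul_map_eq_one (hvσ : ∀ a, Valued.v (σ a) = Valued.v a) {x : K} (hx : x * σ x = 1) : Valued.v x = 1 := by
  have h : Valued.v x * Valued.v x = 1 := by rw [← hvσ x] ; nth_rw 1 [hvσ x]; rw [← map_mul, hx, map_one]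
  rw [← pow_two] at h
  exact ((pow_eq_one_iff).1 h).resolve_right two_ne_zero

omit [Valued K ℤᵐ⁰] in
/-- `(x∕u)·σ(x∕u) = 1` for `σ`-norm-one `x, u`. [cite: Rogawski1990, §3.6 p. 31] -/
theorem div_mul_map_div_eq_one {x u : K} (hx : x * σ x = 1) (hu : u * σ u = 1) : x / u * σ (x / u) = 1 := by
  have hu0 : u ≠ 0 := fun h => by rw [h, zero_mul] at hu; exact zero_ne_one hu
  have hσu0 : σ u ≠ 0 := fun h => by rw [h, mul_zero] at hu; exact zero_ne_one hu
  rw [map_div₀]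
  field_simp
  rw [hx, hu]

/-- `|x∕u − 1| = |x − u|` for `|u| = 1`. [cite: Serre1980Trees, II.1.1] -/
theorem v_div_sub_one_eq {x u : K} (hu : Valued.v u = 1) : Valued.v (x / u - 1) = Valued.v (x - u) := by
  have hu0 : u ≠ 0 := fun h => by rw [h, map_zero] at hu; exact zero_ne_one hu
  rw [show x / u - 1 = (x - u) / u by field_simp, map_div₀, hu, div_one]

/-- `|x∕u − y∕u| = |x − y|` for `|u| = 1`. [cite: Serre1980Trees, II.1.1] -/
theorem v_div_sub_div_eq {x y u : K} (hu : Valued.v u = 1) : Valued.v (x / u - y / u) = Valued.v (x - y) := by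
  rw [← sub_div, map_div₀, hu, div_one]

/-! ## §2 The literal in the `J₀`-model: `A·diag(s)·A⁻¹ ∈ U(σ, J₀) ∩ GL₃(𝒪)` for the ★ frame `A` of a diagonal unit form -/

omit [Valued K ℤᵐ⁰] in
/-- A diagonal matrix of `σ`-norm-one entries preserves every diagonal form (local copy of ★ `diagonal_mem_unitaryGroupOfForm_diagonal`, kept private to stay import-light).
[cite: Rogawski1990, §3.6 p. 31] -/
private theorem diagonal_mem_unitaryGroupOfForm_diagonal' {D : GL (Fin 3) K} {s : Fin 3 → K} (hD : (D : Matrix (Fin 3) (Fin 3) K) = Matrix.diagonal s)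
    (hsσ : ∀ i, s i * σ (s i) = 1) (d : Fin 3 → K) : D ∈ unitaryGroupOfForm σ (Matrix.diagonal d) := by
  rw [mem_unitaryGroupOfForm_iff, hD, Matrix.diagonal_map (map_zero σ), Matrix.diagonal_transpose, Matrix.diagonal_mul_diagonal, Matrix.diagonal_mul_diagonal]
  congr 1
  funext i
  rw [mul_comm (σ (s i)) (d i), mul_assoc, mul_comm (σ (s i)), hsσ i, mul_one]

omit [Valued K ℤᵐ⁰] in
/-- **The diagonal literal as an element of `U(σ, diag d)`**: for `σ`-norm-one `s` there is `T ∈ U(σ, diag d)` with `↑T = diag(s)` (the `T` binder of ★ J4a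
`finite_setOf_latticeGraphIso_diagonal_eq`). [cite: Rogawski1990, §3.6 p. 31] -/
theorem exists_unitary_diagonal_coe_eq_diagonal (d s : Fin 3 → K) (hsσ : ∀ i, s i * σ (s i) = 1) :
    ∃ T : unitaryGroupOfForm σ (Matrix.diagonal d), ((T : GL (Fin 3) K) : Matrix (Fin 3) (Fin 3) K) = Matrix.diagonal s := by
  let D : GL (Fin 3) K :=
    ⟨Matrix.diagonal s, Matrix.diagonal fun i => σ (s i),
      by rw [Matrix.diagonal_mul_diagonal, ← Matrix.diagonal_one]; congr 1; funext i; exact hsσ i,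
      by rw [Matrix.diagonal_mul_diagonal, ← Matrix.diagonal_one]; congr 1; funext i; rw [mul_comm]; exact hsσ i⟩
  exact ⟨⟨D, diagonal_mem_unitaryGroupOfForm_diagonal' rfl hsσ d⟩, rfl⟩

/-- **THE LITERAL IN THE `J₀`-MODEL**: for a diagonal unit form `diag d = (−det diag d) • ᵗσ(A) J₀ A` (★ J1's frame, `A, A⁻¹` integral) and `σ`-norm-one `s₀, s₁, s₂`, the element
`A·diag(s)·A⁻¹` lies in `U(σ, J₀) ∩ GL₃(𝒪)` — an element `γ ∈ unitaryInt σ J₀` with `↑γ = A·diag(s)·A⁻¹`, the shape of the junction's `hγ0 ∕ hγA` binders.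
[cite: Rogawski1990, §4.9 p. 55; §3.6 p. 31] [cite: Kottwitz1986, §3] [cite: BruhatTits1972, §10] -/
theorem exists_mem_unitaryInt_coe_eq_conj_diagonal (hvσ : ∀ a, Valued.v (σ a) = Valued.v a) {d : Fin 3 → K} (hd : ∀ i, Valued.v (d i) = 1)
    {A : GL (Fin 3) K} (hA : IsIntMatrix (A : Matrix (Fin 3) (Fin 3) K)) (hA' : IsIntMatrix ((A⁻¹ : GL (Fin 3) K) : Matrix (Fin 3) (Fin 3) K))
    (hdA : Matrix.diagonal d = (-(Matrix.diagonal d).det) • formCongr σ A ((StdForm.antidiagonal 3).over K))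
    (s : Fin 3 → K) (hsσ : ∀ i, s i * σ (s i) = 1) :
    ∃ γ : unitaryGroupOfForm σ ((StdForm.antidiagonal 3).over K), γ ∈ unitaryInt σ ((StdForm.antidiagonal 3).over K) ∧
      ((γ : GL (Fin 3) K) : Matrix (Fin 3) (Fin 3) K) = (A : Matrix (Fin 3) (Fin 3) K) * Matrix.diagonal s * ((A⁻¹ : GL (Fin 3) K) : Matrix (Fin 3) (Fin 3) K) := by
  have hs0 : ∀ i, s i ≠ 0 := fun i h => by have := hsσ i; rw [h, zero_mul] at this; exact zero_ne_one this
  have hsv : ∀ i, Valued.v (s i) = 1 := fun i => v_eq_one_of_mul_map_eq_one hvσ (hsσ i)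
  have hsv' : ∀ i, Valued.v (σ (s i)) = 1 := fun i => by rw [hvσ]; exact hsv i
  -- the diagonal unit `D = diag(s)`, `D⁻¹ = diag(σ s)`
  let D : GL (Fin 3) K :=
    ⟨Matrix.diagonal s, Matrix.diagonal fun i => σ (s i),
      by rw [Matrix.diagonal_mul_diagonal, ← Matrix.diagonal_one]; congr 1; funext i; exact hsσ i,
      by rw [Matrix.diagonal_mul_diagonal, ← Matrix.diagonal_one]; congr 1; funext i; rw [mul_comm]; exact hsσ i⟩
  have hD : (D : Matrix (Fin 3) (Fin 3) K) = Matrix.diagonal s := rfl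
  have hDi : ((D⁻¹ : GL (Fin 3) K) : Matrix (Fin 3) (Fin 3) K) = Matrix.diagonal fun i => σ (s i) := rfl
  -- `D ∈ U(σ, diag d) = U(σ, c • ᵗσ(A) J₀ A) = U(σ, ᵗσ(A) J₀ A)`, so `A D A⁻¹ ∈ U(σ, J₀)`
  have hc : IsUnit (-(Matrix.diagonal d).det) := by
    refine Ne.isUnit fun h => ?_
    have h1 := v_det_diagonal_of_v_eq_one d hd
    rw [neg_eq_zero.1 h, map_zero] at h1
    exact zero_ne_one h1
  have hDmem : D ∈ unitaryGroupOfForm σ (formCongr σ A ((StdForm.antidiagonal 3).over K)) := by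
    rw [← unitaryGroupOfForm_smul_of_isUnit σ hc, ← hdA]
    exact diagonal_mem_unitaryGroupOfForm_diagonal' hD hsσ d
  have hmem : A * D * A⁻¹ ∈ unitaryGroupOfForm σ ((StdForm.antidiagonal 3).over K) := conj_mem_unitaryGroupOfForm σ A _ hDmem
  refine ⟨⟨A * D * A⁻¹, hmem⟩, ?_, ?_⟩
  · rw [mem_unitaryInt_iff]
    refine ⟨?_, ?_⟩
    · change IsIntMatrix (((A * D * A⁻¹ : GL (Fin 3) K)) : Matrix (Fin 3) (Fin 3) K)
      rw [Units.val_mul, Units.val_mul, hD]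
      exact isIntMatrix_mul (isIntMatrix_mul hA (isIntMatrix_diagonal_of_v_eq_one s hsv)) hA'
    · change IsIntMatrix ((((A * D * A⁻¹ : GL (Fin 3) K))⁻¹ : GL (Fin 3) K) : Matrix (Fin 3) (Fin 3) K)
      rw [_root_.mul_inv_rev, _root_.mul_inv_rev, inv_inv, Units.val_mul, Units.val_mul, hDi]
      exact isIntMatrix_mul hA (isIntMatrix_mul (isIntMatrix_diagonal_of_v_eq_one _ hsv') hA')
  · change (((A * D * A⁻¹ : GL (Fin 3) K)) : Matrix (Fin 3) (Fin 3) K) = _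
    rw [Units.val_mul, Units.val_mul, hD]

/-- **THE HEAD'S LITERAL, NORMALISED BY ITS MIDDLE EIGENVALUE, IN THE `J₀`-MODEL** (the junction's `γ`, `hγ0`, `hγA`, `hs1`, `hsv`, `hsσ` binders from the head's data): for
`σ`-norm-one `α u γ` and the ★ frame `A` of `diag d`, there is `γ′ ∈ U(σ, J₀) ∩ GL₃(𝒪)` with `↑γ′ = A·diag(α∕u, 1, γ∕u)·A⁻¹`, and `s = (α∕u, 1, γ∕u)` has `s 1 = 1`,
`|s i| = 1`, `s i·σ(s i) = 1`. [cite: Rogawski1990, §4.9 p. 55; §3.6 p. 31] [cite: Kottwitz1986, §3] -/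
theorem exists_mem_unitaryInt_coe_eq_conj_diagonal_div (hvσ : ∀ a, Valued.v (σ a) = Valued.v a) {d : Fin 3 → K} (hd : ∀ i, Valued.v (d i) = 1)
    {A : GL (Fin 3) K} (hA : IsIntMatrix (A : Matrix (Fin 3) (Fin 3) K)) (hA' : IsIntMatrix ((A⁻¹ : GL (Fin 3) K) : Matrix (Fin 3) (Fin 3) K))
    (hdA : Matrix.diagonal d = (-(Matrix.diagonal d).det) • formCongr σ A ((StdForm.antidiagonal 3).over K))
    {α u γ : K} (hα : α * σ α = 1) (hu : u * σ u = 1) (hγ : γ * σ γ = 1) :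
    (![α / u, 1, γ / u] : Fin 3 → K) 1 = 1 ∧ (∀ i, Valued.v ((![α / u, 1, γ / u] : Fin 3 → K) i) = 1) ∧
      (∀ i, (![α / u, 1, γ / u] : Fin 3 → K) i * σ ((![α / u, 1, γ / u] : Fin 3 → K) i) = 1) ∧
      ∃ γ' : unitaryGroupOfForm σ ((StdForm.antidiagonal 3).over K), γ' ∈ unitaryInt σ ((StdForm.antidiagonal 3).over K) ∧
        ((γ' : GL (Fin 3) K) : Matrix (Fin 3) (Fin 3) K) = (A : Matrix (Fin 3) (Fin 3) K) * Matrix.diagonal ![α / u, 1, γ / u] * ((A⁻¹ : GL (Fin 3) K) : Matrix (Fin 3) (Fin 3) K) := by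
  have hsσ : ∀ i, (![α / u, 1, γ / u] : Fin 3 → K) i * σ ((![α / u, 1, γ / u] : Fin 3 → K) i) = 1 := by
    intro i
    fin_cases i
    · exact div_mul_map_div_eq_one hα hu
    · simp
    · exact div_mul_map_div_eq_one hγ hu
  exact ⟨rfl, fun i => v_eq_one_of_mul_map_eq_one hvσ (hsσ i), hsσ, exists_mem_unitaryInt_coe_eq_conj_diagonal hvσ hd hA hA' hdA _ hsσ⟩

/-- **THE DEPTHS OF THE NORMALISED SPECTRUM** (the junction's `hs0 hs2 hs02` from the head's `hN₁ hN₂ hN`): `|α∕u − 1| = |α − u|`, `|γ∕u − 1| = |u − γ|`, `|α∕u − γ∕u| = |α − γ|`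
(`|u| = 1`). [cite: Rogawski1990, §4.9 p. 55] -/
theorem v_spectrum_div_sub (hvσ : ∀ a, Valued.v (σ a) = Valued.v a) {α u γ : K} (hu : u * σ u = 1) :
    Valued.v ((![α / u, 1, γ / u] : Fin 3 → K) 0 - 1) = Valued.v (α - u) ∧ Valued.v ((![α / u, 1, γ / u] : Fin 3 → K) 2 - 1) = Valued.v (u - γ) ∧
      Valued.v ((![α / u, 1, γ / u] : Fin 3 → K) 0 - (![α / u, 1, γ / u] : Fin 3 → K) 2) = Valued.v (α - γ) := by
  have huv : Valued.v u = 1 := v_eq_one_of_mul_map_eq_one hvσ hu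
  refine ⟨?_, ?_, ?_⟩
  · exact v_div_sub_one_eq huv
  · rw [show (![α / u, 1, γ / u] : Fin 3 → K) 2 = γ / u from rfl, v_div_sub_one_eq huv, ← Valuation.map_neg, neg_sub]
  · exact v_div_sub_div_eq huv

end Literature.NumberTheory.Automorphic.UnitaryLatticeTree

end
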